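import Summits.BirchSwinnertonDyer.BirchSwinnertonDyer.Theorems.ManinLocalTwoThreeShiftInvariantLift
import Summits.BirchSwinnertonDyer.BirchSwinnertonDyer.Theorems.ManinLocalTwoThreeSymbolLemmaGBottom
import Summits.BirchSwinnertonDyer.BirchSwinnertonDyer.Theorems.ManinLocalTwoThreeDiamondEisenstein
import HarnessLib

/-!
# ASSEMBLY of E-es-35 `ShiftInvariantIsDiamond p t n` — hence of the leaf E-es-25 `RelativeIharaShiftVanishingBar p t n` —
# from exactly TWO remaining inputs: PARABOLICITY of non-Eisenstein generalised eigenclasses and the boundary annihilator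
# (BND) (= E-es-30 `BoundaryEisenstein` + linear algebra)

Summit `BirchSwinnertonDyer`, route `ManinLocalTwoThree` (cell bsd-f2-manin), cruxes C2 `ManinOddAtFour`
(stmt-BirchSwinnertonDyer-22967) / C3 `ManinPrimeToThreeAtNine` (stmt-BirchSwinnertonDyer-22968); registered stubs
`stub_relativeIharaBarTwo : ∀ t n, RelativeIharaShiftVanishingBar 2 t n` / `stub_relativeIharaBar331 : RelativeIharaShiftVanishingBar 3 3 1`.
The leaf rests on E-es-35 alone (`relativeIharaShiftVanishingBar_of_shiftInvariantIsDiamond`, p3).  This file proves the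
body of E-es-35 (the hypothesis `h1` of the typer's bridge, VERBATIM) from:

* **(PAR)** PARABOLICITY: under the leaf's binders, either `λ̄` is Eisenstein or `u` kills every `γ ∈ Γ₀(L)` fixing a point
  of `P¹(ℚ)` (the `∂`-side twin of E-es-30: the restriction `Hom(Γ₀(L),K) → ⊕_cusps Hom(Γ₀(L)_c, K)` is Hecke-equivariant
  onto an Eisenstein module; OPEN at filing, cell ask p3 → p2 2026-08-28);
* **(BND)** the BOUNDARY ANNIHILATOR: for `λ̄` non-Eisenstein and any requested exponents `k`, a word of Hecke polynomials
  `q_r ≡ 1 mod (X − λ(r))^{k r}` (`r ∉ S`, `r ∤ tⁿ`, `r ∤ L tⁿ`) killing every boundary symbol of level `L tⁿ` (= E-es-30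
  `BoundaryEisenstein (L tⁿ)` — p2 — plus the spectral-projector linear algebra);

via the chain: (PAR) ⟹ `u` parabolic ⟹ LIFT (`exists_shift_invariant_lift_of_boundaryKilled`, p3, using (BND)): `u = δΦ` with
`Φ` additive, `Γ₀(L)`- and `A_tⁿ`-invariant ⟹ CORE (`exists_diamondFun_of_invariant_of_shift_invariant`, p3 over p1's LEMMA G
and Vaserstein): `u = diamondFun L (L/t^{v_t L}) K η` — the second disjunct of E-es-35.

* `shiftInvariantIsDiamond_body_of_parabolic_of_boundaryKilled (hPAR) (hBND)` — the `h1` body;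
* `relativeIharaShiftVanishingBar_of_parabolic_of_boundaryKilled (hPAR) (hBND) : RelativeIharaShiftVanishingBar p t n` —
  THE LEAF from (PAR) ∧ (BND), BY NAME.

Nothing about BSD or Manin's conjecture is proved here; the two hypotheses are genuine (E-es-30 and its `∂`-twin).
References: HOME/MEMO-es.md §23 (cell bsd-f2-manin); typer's `RelativeIharaShiftVanishingEdges.lean` (the bridge).
-/

set_option autoImplicit false
set_option linter.dupNamespace false

open scoped MatrixGroups Polynomial

open CongruenceSubgroup Matrix.SpecialLinearGroup Polynomial Literature.NumberTheory.EllipticCurves.ModularForms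
  Literature.NumberTheory.EllipticCurves.ModularForms.HidaCohomology
  Summit.BirchSwinnertonDyer.Rank1Residual.ManinAdditive

namespace Summit.BirchSwinnertonDyer.BirchSwinnertonDyer.Theorems.ManinLocalTwoThree

noncomputable section

/-- The core at an arbitrary level `L = tᵏ L'` (transport of `exists_diamondFun_of_invariant_of_shift_invariant` along
`tᵏ L' = L`). [folklore] -/
theorem exists_diamondFun_of_invariant_of_shift_invariant_of_eq {t n k L' L : ℕ} [NeZero t] {K : Type*} [CommRing K]
    (A : GL (Fin 2) ℚ) (hA : (A : Matrix (Fin 2) (Fin 2) ℚ) = !![((t : ℚ) ^ n), 0; 0, 1]) (hL : t ^ k * L' = L)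
    (htp : t.Prime) (hn : 1 ≤ n) (hL' : ¬ t ∣ L') [NeZero L']
    (Φ : OnePoint ℚ → OnePoint ℚ → K) (hsym : ∀ a b c, Φ a b + Φ b c = Φ a c)
    (hinv : ∀ γ : Gamma0 L, ∀ a b, Φ (mapGL ℚ (γ : SL(2, ℤ)) • a) (mapGL ℚ (γ : SL(2, ℤ)) • b) = Φ a b)
    (hAinv : ∀ a b, Φ (A • a) (A • b) = Φ a b) :
    ∃ η : ZMod L' → K, (∀ a b : ZMod L', IsUnit a → IsUnit b → η (a * b) = η a + η b) ∧
      (fun (γ : Gamma0 L) (_ : Fin 1) => Φ OnePoint.infty (mapGL ℚ (γ : SL(2, ℤ)) • OnePoint.infty)) =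
        diamondFun L L' K η := by
  subst hL
  exact exists_diamondFun_of_invariant_of_shift_invariant A hA htp hn hL' Φ hsym hinv hAinv

/-- **E-es-35 (the `h1` body of the typer's bridge) from (PAR) and (BND).** [folklore] -/
theorem shiftInvariantIsDiamond_body_of_parabolic_of_boundaryKilled {p t n : ℕ}
    (hPAR : ∀ (K : Type) [Field K] [CharP K p] (L : ℕ) [NeZero L] (S : Finset ℕ) (lam : ℕ → K) (u : cocycles 0 L K),
      (∀ q : ℕ, q.Prime → q ∣ p * t * L → q ∈ S) → IsHeckeGenEigenvector S lam u →
      IsEisensteinEigensystem 2 (fun ℓ => algebraMap K (AlgebraicClosure K) (lam ℓ)) ∨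
        ∀ γ : Gamma0 L, ∀ c : OnePoint ℚ, mapGL ℚ (γ : SL(2, ℤ)) • c = c → (u : Gamma0 L → Fin 1 → K) γ 0 = 0)
    (hBND : ∀ (K : Type) [Field K] [CharP K p] (L : ℕ) [NeZero L] (S : Finset ℕ) (lam : ℕ → K),
      (∀ q : ℕ, q.Prime → q ∣ p * t * L → q ∈ S) →
      ¬ IsEisensteinEigensystem 2 (fun ℓ => algebraMap K (AlgebraicClosure K) (lam ℓ)) →
      ∀ k : ℕ → ℕ, ∃ F : List ({r : ℕ // r.Prime} × K[X]),
        (∀ rq ∈ F, rq.1.1 ∉ S ∧ ¬ rq.1.1 ∣ t ^ n ∧ ¬ rq.1.1 ∣ L * t ^ n ∧ (X - C (lam rq.1.1)) ^ (k rq.1.1) ∣ rq.2 - 1) ∧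
        ∀ Ψ : OnePoint ℚ → OnePoint ℚ → K, (∀ a b c, Ψ a b + Ψ b c = Ψ a c) →
          (∀ γ : Gamma0 (L * t ^ n), ∀ a b, Ψ (mapGL ℚ (γ : SL(2, ℤ)) • a) (mapGL ℚ (γ : SL(2, ℤ)) • b) = Ψ a b) →
          (∀ γ : Gamma0 (L * t ^ n), Ψ OnePoint.infty (mapGL ℚ (γ : SL(2, ℤ)) • OnePoint.infty) = 0) →
          F.foldr (fun rq Ψ => aeval (@symbolHecke L rq.1.1 ⟨rq.1.2.ne_zero⟩ K _) rq.2 Ψ) Ψ = 0) :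
    p.Prime → t.Prime → 1 ≤ n →
      ∀ (K : Type) [Field K] [CharP K p] (L : ℕ) [NeZero L] [NeZero t] (S : Finset ℕ)
        (lam : ℕ → K) (u : cocycles 0 L K),
        (∀ q : ℕ, q.Prime → q ∣ p * t * L → q ∈ S) →
        IsHeckeGenEigenvector S lam u →
        degeneracyPullback 0 L (L * t ^ n) (t ^ n) K dvd_rfl (u : Gamma0 L → Fin 1 → K) =
          degeneracyPullback 0 L (L * t ^ n) 1 K (by simp) (u : Gamma0 L → Fin 1 → K) →
        IsEisensteinEigensystem 2 (fun ℓ => algebraMap K (AlgebraicClosure K) (lam ℓ)) ∨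
          ∃ η : ZMod (L / t ^ (L.factorization t)) → K,
            (∀ a b : ZMod (L / t ^ (L.factorization t)), IsUnit a → IsUnit b → η (a * b) = η a + η b) ∧
            (u : Gamma0 L → Fin 1 → K) = diamondFun L (L / t ^ (L.factorization t)) K η := by
  intro _ ht hn K _ _ L _ _ S lam u hS hu hshift
  classical
  by_cases hE : IsEisensteinEigensystem 2 (fun ℓ => algebraMap K (AlgebraicClosure K) (lam ℓ))
  · exact Or.inl hE
  right
  have hpar := (hPAR K L S lam u hS hu).resolve_left hE
  -- the shift matrix `A = diag(tⁿ, 1)`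
  have hdet : (!![((t ^ n : ℕ) : ℚ), 0; 0, 1] : Matrix (Fin 2) (Fin 2) ℚ).det ≠ 0 := by
    rw [Matrix.det_fin_two_of]
    simp [NeZero.ne t]
  let A : GL (Fin 2) ℚ := Matrix.GeneralLinearGroup.mkOfDetNeZero _ hdet
  have hA : (A : Matrix (Fin 2) (Fin 2) ℚ) = !![((t ^ n : ℕ) : ℚ), 0; 0, 1] := rfl
  have hA' : (A : Matrix (Fin 2) (Fin 2) ℚ) = !![((t : ℚ) ^ n), 0; 0, 1] := by rw [hA, Nat.cast_pow]
  haveI : NeZero (t ^ n) := ⟨pow_ne_zero n (NeZero.ne t)⟩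
  -- the LIFT, fed with (BND)
  obtain ⟨Φ, hsym, hinv, hAinv, hδ⟩ := exists_shift_invariant_lift_of_boundaryKilled (L := L) (L' := L * t ^ n)
    (d := t ^ n) dvd_rfl (by simp) A hA lam u hu hpar hshift (hBND K L S lam hS hE)
  -- the CORE at `L = t^{v_t L} · (L / t^{v_t L})`
  haveI : NeZero (L / t ^ (L.factorization t)) := ⟨(Nat.ordCompl_pos t (NeZero.ne L)).ne'⟩
  obtain ⟨η, hη, hdiam⟩ := exists_diamondFun_of_invariant_of_shift_invariant_of_eq A hA'
    (Nat.ordProj_mul_ordCompl_eq_self L t) ht hn (Nat.not_dvd_ordCompl ht (NeZero.ne L)) Φ hsym hinv hAinv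
  exact ⟨η, hη, by rw [← hδ, hdiam]⟩

/-- **THE LEAF E-es-25 from (PAR) ∧ (BND), BY NAME** (through E-es-35 and the typer's bridge with E-es-33 discharged).
[folklore] -/
theorem relativeIharaShiftVanishingBar_of_parabolic_of_boundaryKilled {p t n : ℕ}
    (hPAR : ∀ (K : Type) [Field K] [CharP K p] (L : ℕ) [NeZero L] (S : Finset ℕ) (lam : ℕ → K) (u : cocycles 0 L K),
      (∀ q : ℕ, q.Prime → q ∣ p * t * L → q ∈ S) → IsHeckeGenEigenvector S lam u →
      IsEisensteinEigensystem 2 (fun ℓ => algebraMap K (AlgebraicClosure K) (lam ℓ)) ∨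
        ∀ γ : Gamma0 L, ∀ c : OnePoint ℚ, mapGL ℚ (γ : SL(2, ℤ)) • c = c → (u : Gamma0 L → Fin 1 → K) γ 0 = 0)
    (hBND : ∀ (K : Type) [Field K] [CharP K p] (L : ℕ) [NeZero L] (S : Finset ℕ) (lam : ℕ → K),
      (∀ q : ℕ, q.Prime → q ∣ p * t * L → q ∈ S) →
      ¬ IsEisensteinEigensystem 2 (fun ℓ => algebraMap K (AlgebraicClosure K) (lam ℓ)) →
      ∀ k : ℕ → ℕ, ∃ F : List ({r : ℕ // r.Prime} × K[X]),
        (∀ rq ∈ F, rq.1.1 ∉ S ∧ ¬ rq.1.1 ∣ t ^ n ∧ ¬ rq.1.1 ∣ L * t ^ n ∧ (X - C (lam rq.1.1)) ^ (k rq.1.1) ∣ rq.2 - 1) ∧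
        ∀ Ψ : OnePoint ℚ → OnePoint ℚ → K, (∀ a b c, Ψ a b + Ψ b c = Ψ a c) →
          (∀ γ : Gamma0 (L * t ^ n), ∀ a b, Ψ (mapGL ℚ (γ : SL(2, ℤ)) • a) (mapGL ℚ (γ : SL(2, ℤ)) • b) = Ψ a b) →
          (∀ γ : Gamma0 (L * t ^ n), Ψ OnePoint.infty (mapGL ℚ (γ : SL(2, ℤ)) • OnePoint.infty) = 0) →
          F.foldr (fun rq Ψ => aeval (@symbolHecke L rq.1.1 ⟨rq.1.2.ne_zero⟩ K _) rq.2 Ψ) Ψ = 0) :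
    RelativeIharaShiftVanishingBar p t n :=
  relativeIharaShiftVanishingBar_of_shiftInvariantIsDiamond
    (shiftInvariantIsDiamond_body_of_parabolic_of_boundaryKilled hPAR hBND)

end

end Summit.BirchSwinnertonDyer.BirchSwinnertonDyer.Theorems.ManinLocalTwoThree
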